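import Summits.PneNP.PneNP.Theorems.ExpanderLinearGeneratorsColumnTwoDefs

/-!
# PneNP / ExpanderLinearGenerators — column weight two: inner edges, cuts, neighbourhoods

Route `PneNP/ExpanderLinearGenerators`, support for crux stmt-PneNP-11443. Bookkeeping for scope
families `S : ι → Finset ℕ` of column weight `≤ 2` (`…ColumnTwoDefs`):

* `sum_card_eq` — `Σ_{i ∈ W} |S i| = |∂W| + 2 e(W)`;
* `eIn_eq_add` — for `W ⊆ U`, `e(U) = e(W) + e(U \\ W) + |cut U W|`;
* `card_cut_le` — `|cut U W| ≤ ℓ |nbr U W|`; `cut_subset_inner_union_nbr`;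
* `boundary_subset_cut_union` — `∂W ⊆ cut U W ∪ ∂U` for `W ⊆ U`;
* `eight_mul_eIn_le` — local sparsity from boundary expansion: `8 e(W) ≤ Σ_{i∈W} |S i|` whenever
  `3 Σ |S i| ≤ 4 |∂W|`.

References: M. Krivelevich, SIAM J. Discrete Math. 32 (2018), §2 [folklore bookkeeping].
-/

namespace Summit.PneNP.PneNP.Theorems.ColumnTwo

open Finset Literature.Computability.MetaComplexity

variable {ι : Type*} [DecidableEq ι] {S : ι → Finset ℕ}

/-! ### Degrees in sub-families -/

/-- The degree of a point in a sub-family is at most its degree in the family. [folklore] -/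
theorem coverDegree_mono {W W' : Finset ι} (h : W ⊆ W') (v : ℕ) :
    coverDegree S W v ≤ coverDegree S W' v :=
  Finset.card_le_card (Finset.filter_subset_filter _ h)

/-- The degree of a point splits over a partition `W ⊆ U`. [folklore] -/
theorem coverDegree_add_sdiff {U W : Finset ι} (h : W ⊆ U) (v : ℕ) :
    coverDegree S W v + coverDegree S (U \ W) v = coverDegree S U v := by
  unfold coverDegree
  rw [← Finset.card_union_of_disjoint (Finset.disjoint_filter_filter Finset.disjoint_sdiff),
    ← Finset.filter_union, Finset.union_sdiff_of_subset h]

/-- The degree in a union is at most the sum of the degrees. [folklore] -/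
theorem coverDegree_union_le (W W' : Finset ι) (v : ℕ) :
    coverDegree S (W ∪ W') v ≤ coverDegree S W v + coverDegree S W' v := by
  unfold coverDegree
  rw [Finset.filter_union]
  exact Finset.card_union_le _ _

/-- A point has positive degree in `W` iff it is covered by `W`. [folklore] -/
theorem coverDegree_pos_iff {W : Finset ι} {v : ℕ} : 0 < coverDegree S W v ↔ v ∈ cover S W := by
  rw [coverDegree, Finset.card_pos, mem_cover]
  constructor
  · rintro ⟨i, hi⟩
    rw [Finset.mem_filter] at hi
    exact ⟨i, hi.1, hi.2⟩
  · rintro ⟨i, hi, hv⟩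
    exact ⟨i, Finset.mem_filter.2 ⟨hi, hv⟩⟩

/-- A point of degree zero is not covered. [folklore] -/
theorem coverDegree_eq_zero_iff {W : Finset ι} {v : ℕ} : coverDegree S W v = 0 ↔ v ∉ cover S W := by
  rw [← coverDegree_pos_iff]; omega

/-- Membership in the inner edges. [folklore] -/
theorem mem_inner {W : Finset ι} {v : ℕ} : v ∈ inner S W ↔ 2 ≤ coverDegree S W v := by
  rw [inner, Finset.mem_filter, and_iff_right_iff_imp]
  intro h
  exact coverDegree_pos_iff.1 (by omega)

/-- Membership in the boundary through the degree alone. [folklore] -/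
theorem mem_boundary_iff_coverDegree {W : Finset ι} {v : ℕ} :
    v ∈ boundary S W ↔ coverDegree S W v = 1 := by
  rw [mem_boundary, and_iff_right_iff_imp]
  intro h
  exact coverDegree_pos_iff.1 (by omega)

/-- Inner edges are monotone. [folklore] -/
theorem inner_mono {W W' : Finset ι} (h : W ⊆ W') : inner S W ⊆ inner S W' := fun v hv =>
  mem_inner.2 ((mem_inner.1 hv).trans (coverDegree_mono h v))

/-- The empty set has no inner edges. [folklore] -/
theorem eIn_empty : eIn S (∅ : Finset ι) = 0 := by
  simp [eIn, inner, cover]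

/-- `e` is monotone. [folklore] -/
theorem eIn_mono {W W' : Finset ι} (h : W ⊆ W') : eIn S W ≤ eIn S W' :=
  Finset.card_le_card (inner_mono h)

/-! ### Column weight at most two -/

section ColumnTwo

variable [Fintype ι] (hcw : ∀ v, coverDegree S Finset.univ v ≤ 2)
include hcw

/-- Every degree is at most two. [folklore] -/
theorem coverDegree_le_two (W : Finset ι) (v : ℕ) : coverDegree S W v ≤ 2 :=
  (coverDegree_mono (Finset.subset_univ W) v).trans (hcw v)

/-- **Handshake**: `Σ_{i ∈ W} |S i| = |∂W| + 2 e(W)`. [folklore] -/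
theorem sum_card_eq (W : Finset ι) :
    ∑ i ∈ W, (S i).card = (boundary S W).card + 2 * eIn S W := by
  classical
  rw [← sum_coverDegree]
  have hsplit : cover S W = boundary S W ∪ inner S W := by
    ext v
    rw [Finset.mem_union, mem_boundary_iff_coverDegree, mem_inner]
    constructor
    · intro hv
      have := one_le_coverDegree hv
      omega
    · rintro (h | h) <;> exact coverDegree_pos_iff.1 (by omega)
  have hdisj : Disjoint (boundary S W) (inner S W) := by
    rw [Finset.disjoint_left]
    intro v h1 h2
    rw [mem_boundary_iff_coverDegree] at h1
    rw [mem_inner] at h2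
    omega
  rw [hsplit, Finset.sum_union hdisj]
  have h1 : ∑ v ∈ boundary S W, coverDegree S W v = ∑ v ∈ boundary S W, 1 :=
    Finset.sum_congr rfl fun v hv => mem_boundary_iff_coverDegree.1 hv
  have h2 : ∑ v ∈ inner S W, coverDegree S W v = ∑ v ∈ inner S W, 2 :=
    Finset.sum_congr rfl fun v hv => le_antisymm (coverDegree_le_two hcw W v) (mem_inner.1 hv)
  rw [h1, h2, Finset.sum_const, Finset.sum_const, smul_eq_mul, smul_eq_mul, eIn]
  ring

/-- **Splitting the inner edges** over `W ⊆ U`: those of `W`, those of `U \\ W`, and the cut.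
[folklore] -/
theorem inner_eq_union {U W : Finset ι} (h : W ⊆ U) :
    inner S U = inner S W ∪ inner S (U \ W) ∪ cut S U W := by
  ext v
  have hadd := coverDegree_add_sdiff (S := S) h v
  have h2 := coverDegree_le_two hcw U v
  simp only [Finset.mem_union, mem_inner, cut, Finset.mem_filter, mem_boundary_iff_coverDegree]
  omega

/-- **`e(U) = e(W) + e(U \\ W) + |cut U W|`** for `W ⊆ U`. [folklore] -/
theorem eIn_eq_add {U W : Finset ι} (h : W ⊆ U) :
    eIn S U = eIn S W + eIn S (U \ W) + (cut S U W).card := by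
  unfold eIn
  rw [inner_eq_union hcw h]
  have d1 : Disjoint (inner S W) (inner S (U \ W)) := by
    rw [Finset.disjoint_left]; intro v h1 h2
    rw [mem_inner] at h1 h2
    have := coverDegree_add_sdiff (S := S) h v
    have := coverDegree_le_two hcw U v
    omega
  have d2 : Disjoint (inner S W ∪ inner S (U \ W)) (cut S U W) := by
    rw [Finset.disjoint_left]; intro v h1 h2
    simp only [Finset.mem_union, mem_inner] at h1
    simp only [cut, Finset.mem_filter, mem_boundary_iff_coverDegree] at h2
    omega
  rw [Finset.card_union_of_disjoint d2, Finset.card_union_of_disjoint d1]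

/-- The boundary of `W ⊆ U` lies in the cut together with the boundary of `U`. [folklore] -/
theorem boundary_subset_cut_union {U W : Finset ι} (h : W ⊆ U) :
    boundary S W ⊆ cut S U W ∪ boundary S U := by
  intro v hv
  have hadd := coverDegree_add_sdiff (S := S) h v
  have h2 := coverDegree_le_two hcw U v
  rw [mem_boundary_iff_coverDegree] at hv
  simp only [Finset.mem_union, cut, Finset.mem_filter, mem_boundary_iff_coverDegree]
  omega

end ColumnTwo

/-! ### Cuts and neighbourhoods -/

/-- A cut point lies in a row of `W` and in a neighbour of `W` inside `U`. [folklore] -/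
theorem exists_of_mem_cut {U W : Finset ι} {v : ℕ} (hv : v ∈ cut S U W) :
    ∃ i ∈ W, ∃ j ∈ nbr S U W, v ∈ S i ∧ v ∈ S j := by
  simp only [cut, Finset.mem_filter, mem_boundary_iff_coverDegree] at hv
  obtain ⟨h1, h2⟩ := hv
  obtain ⟨i, hi⟩ := Finset.card_pos.1 (by rw [coverDegree] at h1; omega : 0 < (W.filter fun i => v ∈ S i).card)
  obtain ⟨j, hj⟩ := Finset.card_pos.1 (by rw [coverDegree] at h2; omega : 0 < ((U \ W).filter fun i => v ∈ S i).card)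
  rw [Finset.mem_filter] at hi hj
  refine ⟨i, hi.1, j, ?_, hi.2, hj.2⟩
  exact Finset.mem_filter.2 ⟨hj.1, i, hi.1, v, Finset.mem_inter.2 ⟨hi.2, hj.2⟩⟩

/-- Neighbours lie in the ambient set and outside `W`. [folklore] -/
theorem nbr_subset_sdiff (U W : Finset ι) : nbr S U W ⊆ U \ W := Finset.filter_subset _ _

/-- **The cut is absorbed by the neighbours**: `|cut U W| ≤ Σ_{j ∈ nbr U W} |S j|`. [folklore] -/
theorem card_cut_le_sum (U W : Finset ι) :
    (cut S U W).card ≤ ∑ j ∈ nbr S U W, (S j).card := by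
  calc (cut S U W).card ≤ ((nbr S U W).biUnion S).card := by
        refine Finset.card_le_card fun v hv => ?_
        obtain ⟨i, -, j, hj, -, hvj⟩ := exists_of_mem_cut hv
        exact Finset.mem_biUnion.2 ⟨j, hj, hvj⟩
    _ ≤ _ := Finset.card_biUnion_le

/-- With scopes of size `≤ ℓ`: `|cut U W| ≤ ℓ |nbr U W|`. [folklore] -/
theorem card_cut_le {ℓ : ℕ} (hℓ : ∀ i, (S i).card ≤ ℓ) (U W : Finset ι) :
    (cut S U W).card ≤ ℓ * (nbr S U W).card := by
  refine (card_cut_le_sum U W).trans ?_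
  calc ∑ j ∈ nbr S U W, (S j).card ≤ ∑ j ∈ nbr S U W, ℓ := Finset.sum_le_sum fun j _ => hℓ j
    _ = _ := by rw [Finset.sum_const, smul_eq_mul, mul_comm]

/-- **Cut points are inner edges of `W ∪ nbr U W`.** [folklore] -/
theorem cut_subset_inner_union_nbr (U W : Finset ι) :
    cut S U W ⊆ inner S (W ∪ nbr S U W) := by
  intro v hv
  obtain ⟨i, hi, j, hj, hvi, hvj⟩ := exists_of_mem_cut hv
  have hij : i ≠ j := by
    rintro rfl
    exact (Finset.mem_sdiff.1 (nbr_subset_sdiff U W hj)).2 hi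
  rw [mem_inner, coverDegree]
  have : ({i, j} : Finset ι) ⊆ (W ∪ nbr S U W).filter fun k => v ∈ S k := by
    intro k hk
    rcases Finset.mem_insert.1 hk with rfl | hk
    · exact Finset.mem_filter.2 ⟨Finset.mem_union_left _ hi, hvi⟩
    · rw [Finset.mem_singleton] at hk; subst hk
      exact Finset.mem_filter.2 ⟨Finset.mem_union_right _ hj, hvj⟩
  refine le_trans ?_ (Finset.card_le_card this)
  rw [Finset.card_pair hij]

/-! ### Local sparsity from boundary expansion -/

/-- **Local sparsity**: if `3 Σ_{i∈W} |S i| ≤ 4 |∂W|` (boundary expansion at rate `3ℓ/4` with scopes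
of size `≤ ℓ`) then `8 e(W) ≤ Σ_{i ∈ W} |S i|`. [folklore] -/
theorem eight_mul_eIn_le [Fintype ι] (hcw : ∀ v, coverDegree S Finset.univ v ≤ 2) {W : Finset ι}
    (h : 3 * ∑ i ∈ W, (S i).card ≤ 4 * (boundary S W).card) :
    8 * eIn S W ≤ ∑ i ∈ W, (S i).card := by
  have := sum_card_eq hcw W
  omega

/-- The expansion hypothesis of the crux in integers: `3 ℓ |W| ≤ 4 |∂W|` for `|W| ≤ r`, hence
`3 Σ_{i ∈ W} |S i| ≤ 4 |∂W|`. [folklore] -/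
theorem three_mul_sum_le {ℓ : ℕ} (hℓ : ∀ i, (S i).card ≤ ℓ) {r : ℝ}
    (hexp : IsBoundaryExpander S r (3 / 4 * ℓ)) {W : Finset ι} (hW : (W.card : ℝ) ≤ r) :
    3 * ∑ i ∈ W, (S i).card ≤ 4 * (boundary S W).card := by
  have h1 := hexp W hW
  have h2 : ∑ i ∈ W, (S i).card ≤ ℓ * W.card := by
    calc ∑ i ∈ W, (S i).card ≤ ∑ i ∈ W, ℓ := Finset.sum_le_sum fun i _ => hℓ i
      _ = _ := by rw [Finset.sum_const, smul_eq_mul, mul_comm]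
  have h3 : (3 * (ℓ * W.card) : ℝ) ≤ 4 * (boundary S W).card := by linarith
  have h4 : 3 * (ℓ * W.card) ≤ 4 * (boundary S W).card := by exact_mod_cast h3
  omega

end Summit.PneNP.PneNP.Theorems.ColumnTwo
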